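import Mathlib
import Summits.Ventures.HodgeRepro.LitRankRibet1

/-!
# LitRankRibet — Dodson 1987 Thm 1.4 (Ribet): `N_g = Φ_p(rt g)`, faithfulness, the two fixed vectors, assembly

Blind cell `pub-hodge-repro`, seat lit-2. Part 2 of 2 of the former single file `LitRankRibet.lean` (split at the ≤ 400-line rule, gen 4; text of every declaration unchanged). Imports `LitRankRibet1` (and through it the rest of the chain).
-/

open Finset Polynomial
open scoped Pointwise

namespace HodgeRepro.Lit2

/-! ## §1, §4–5  `N_g = Φ_p(rt g)`; faithfulness; the two fixed vectors -/

namespace CMTriple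

variable {G : Type*} [Group G] [Fintype G] [DecidableEq G] (T : CMTriple G)

/-! ### `N_g = Φ_p(rt g)` for `p` prime -/

omit [Fintype G] [DecidableEq G] in
/-- `N_g = Φ_p(rt g)` for `p` prime (`Φ_p = 1 + X + ⋯ + X^{p−1}`). -/
theorem normOp_eq_aeval_cyclotomic (g : G) (p : ℕ) [Fact p.Prime] :
    normOp g p = aeval (rt g) (cyclotomic p ℚ) := by
  rw [cyclotomic_prime ℚ p, map_sum]
  unfold normOp
  refine Finset.sum_congr rfl fun k _ => ?_
  rw [aeval_X_pow, rt_pow]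

/-! ### Faithfulness (Dodson p.51: "no element of Gal(K^c/Q) fixes every element of the orbit of Φ") -/

omit [Fintype G] in
/-- If `S̃ x g = S̃ x` for every `x` then `S̃` is right-invariant under every conjugate of `g`. -/
theorem mem_iff_mul_conj_mem_of_forall (g : G) (hall : ∀ x : G, T.S.image (· * (x * g)) = T.S.image (· * x))
    (t x : G) : t ∈ T.S ↔ t * (x * g * x⁻¹) ∈ T.S := by
  have h := hall x
  have h1 : t * x * g ∈ T.S.image (· * (x * g)) ↔ t * x * g ∈ T.S.image (· * x) := by rw [h]
  rw [T.mem_image_mul_right_iff, T.mem_image_mul_right_iff] at h1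
  have e1 : t * x * g * (x * g)⁻¹ = t := by group
  have e2 : t * x * g * x⁻¹ = t * (x * g * x⁻¹) := by group
  rw [e1, e2] at h1
  exact h1

/-- **Faithfulness**: for a simple triple with `normalCore H = 1`, no `g ≠ 1` fixes every conjugate
`S̃ x` (as `x ↦ S̃ x g`). -/
theorem exists_image_mul_ne_of_core (hs : T.IsSimple) (hcore : T.H.normalCore = ⊥) {g : G}
    (hg : g ≠ 1) : ∃ x : G, T.S.image (· * (x * g)) ≠ T.S.image (· * x) := by
  by_contra hall
  have hall' : ∀ x : G, T.S.image (· * (x * g)) = T.S.image (· * x) := fun x => by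
    by_contra h; exact hall ⟨x, h⟩
  apply hg
  have hmem : g ∈ T.H.normalCore := by
    intro b
    apply hs
    apply Finset.eq_of_subset_of_card_le
    · intro y hy
      rw [Finset.mem_smul_finset] at hy
      obtain ⟨s, hs', rfl⟩ := hy
      rw [smul_eq_mul]
      have e : b * g * b⁻¹ * s = s * ((s⁻¹ * b) * g * (s⁻¹ * b)⁻¹) := by group
      rw [e]
      exact (T.mem_iff_mul_conj_mem_of_forall g hall' s (s⁻¹ * b)).mp hs'
    · rw [Finset.card_smul_finset]
  rw [hcore, Subgroup.mem_bot] at hmem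
  exact hmem

/-! ### The two fixed vectors `N_g 𝟙_{S̃}` and `𝟙_G` are linearly independent (Dodson p.51) -/

omit [Fintype G] [DecidableEq G] in
/-- Constant functions are fixed by every `rt g`. -/
theorem rt_const (g : G) (c : ℚ) : rt g (fun _ : G => c) = fun _ => c := by
  ext y; rfl

omit [Fintype G] in
/-- `V` is stable under `N_g`. -/
theorem normOp_mem_V (g : G) (p : ℕ) {f : G → ℚ} (hf : f ∈ T.V) : normOp g p f ∈ T.V := by
  unfold normOp
  rw [LinearMap.sum_apply]
  exact Submodule.sum_mem _ fun k _ => T.rt_mem_V _ hf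

omit [Fintype G] in
/-- `𝟙_{S̃} ∈ V` (the conjugate by `1`). -/
theorem indFun_S_mem_V : indFun T.S ∈ T.V := by
  have h : indFun T.S = indFun (T.S.image (· * (1 : G))) := by simp
  rw [h]
  exact T.indFun_image_mem_V 1

/-- `∑_y 𝟙_{S̃}(y c) = |S̃|`. -/
theorem sum_indFun_mul (c : G) : ∑ y : G, indFun T.S (y * c) = (T.S.card : ℚ) := by
  have h := Equiv.sum_comp (Equiv.mulRight c) (indFun T.S)
  simp only [Equiv.coe_mulRight] at h
  rw [h]
  simp [indFun]

omit [Fintype G] in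
/-- The value of `N_g 𝟙_{S̃}` at `y` is the number of `k < p` with `y (g^k)⁻¹ ∈ S̃`. -/
theorem normOp_indFun_apply (g : G) (p : ℕ) (y : G) :
    normOp g p (indFun T.S) y = (((range p).filter fun k => y * (g ^ k)⁻¹ ∈ T.S).card : ℚ) := by
  rw [normOp_apply]
  simp [indFun, Finset.sum_boole]

/-- `∑_y N_g 𝟙_{S̃}(y) = p |S̃|`. -/
theorem sum_normOp_indFun (g : G) (p : ℕ) :
    ∑ y : G, normOp g p (indFun T.S) y = (p : ℚ) * T.S.card := by
  simp only [normOp_apply]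
  rw [Finset.sum_comm]
  simp only [T.sum_indFun_mul, Finset.sum_const, Finset.card_range, nsmul_eq_mul]

/-- **Dodson's independence**: `N_g 𝟙_{S̃}` and `𝟙_G` are linearly independent for `p` odd (the
coefficient comparison `c · 2n = p n` forces `c = p/2 ∉ ℤ`). -/
theorem linearIndependent_normOp_one (g : G) (p : ℕ) (hp : p.Prime) (hp2 : p ≠ 2) :
    LinearIndependent ℚ ![normOp g p (indFun T.S), fun _ : G => (1 : ℚ)] := by
  rw [LinearIndependent.pair_iff]
  intro s t hst
  -- sum over `G`
  have hsum := congrArg (fun f : G → ℚ => ∑ y : G, f y) hst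
  simp only [Pi.add_apply, Pi.smul_apply, smul_eq_mul, Finset.sum_add_distrib, ← Finset.mul_sum,
    Finset.sum_const, Finset.card_univ, nsmul_eq_mul, mul_one, Pi.zero_apply,
    T.sum_normOp_indFun] at hsum
  -- value at `1`
  have hone := congrFun hst 1
  simp only [Pi.add_apply, Pi.smul_apply, smul_eq_mul, mul_one, Pi.zero_apply,
    T.normOp_indFun_apply] at hone
  set n₁ := ((range p).filter fun k => (1 : G) * (g ^ k)⁻¹ ∈ T.S).card with hn₁
  have hcardG : (Fintype.card G : ℚ) = 2 * T.S.card := by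
    rw [← T.two_mul_card_S]; push_cast; ring
  have hS : (T.S.card : ℚ) ≠ 0 := by
    have h := T.two_mul_card_S
    have : 0 < Fintype.card G := Fintype.card_pos
    exact_mod_cast (by omega : T.S.card ≠ 0)
  rw [hcardG] at hsum
  -- `s p + 2 t = 0` and `s n₁ + t = 0`, hence `s (p − 2 n₁) = 0`
  have h1 : s * p + 2 * t = 0 := by
    have : (T.S.card : ℚ) * (s * p + 2 * t) = 0 := by linear_combination hsum
    exact (mul_eq_zero.mp this).resolve_left hS
  have h2 : s * ((p : ℚ) - 2 * n₁) = 0 := by linear_combination h1 - 2 * hone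
  have hodd : (p : ℚ) - 2 * n₁ ≠ 0 := by
    intro h
    have h' : (p : ℚ) = 2 * n₁ := by linear_combination h
    have h'' : p = 2 * n₁ := by exact_mod_cast h'
    have := hp.eq_two_or_odd'.resolve_left hp2
    rw [h''] at this
    exact (Nat.not_even_iff_odd.mpr this) (even_two_mul n₁)
  have hs0 : s = 0 := (mul_eq_zero.mp h2).resolve_right hodd
  refine ⟨hs0, ?_⟩
  rw [hs0] at hone
  linear_combination hone

end CMTriple

/-! ## §6  Assembly and the discharge -/

namespace CMTriple

/-- `indFun` is injective. -/
theorem indFun_injective {G : Type*} [DecidableEq G] : Function.Injective (indFun (G := G)) := by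
  intro A B h
  ext y
  have := congrFun h y
  simp only [indFun] at this
  by_cases hA : y ∈ A <;> by_cases hB : y ∈ B <;> simp_all

variable {G : Type*} [Group G] [Fintype G] [DecidableEq G] (T : CMTriple G)

/-- **Ribet's bound, faithful case** (Dodson 1987 p.51–52): a simple triple with `normalCore H = 1`
and an odd prime `p ∣ d` has `rank ≥ p + 1`: `V ⊇ span{N_g 𝟙_{S̃}, 𝟙_G} ⊕ span{φ^k w : k < p−1}` with
`φ = rt g`, `g` of order `p` (Cauchy), `w = v − φ v ≠ 0` killed by `Φ_p(φ)` (faithfulness). -/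
theorem add_one_le_rank_of_core (hs : T.IsSimple) (hcore : T.H.normalCore = ⊥) (p : ℕ)
    (hp : p.Prime) (hp2 : p ≠ 2) (hpd : p ∣ T.dim) : p + 1 ≤ T.rank := by
  classical
  haveI : Fact p.Prime := ⟨hp⟩
  -- Cauchy
  obtain ⟨g, hg⟩ := exists_prime_orderOf_dvd_card p (hpd.trans T.dim_dvd_card)
  have hg1 : g ≠ 1 := by
    intro h; rw [h, orderOf_one] at hg; exact hp.one_lt.ne hg
  have hgp : g ^ p = 1 := by rw [← hg]; exact pow_orderOf_eq_one g
  -- a moved conjugate, and `w = v − φ v ≠ 0`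
  obtain ⟨x, hx⟩ := T.exists_image_mul_ne_of_core hs hcore hg1
  set φ : Module.End ℚ (G → ℚ) := rt g with hφ
  set v : G → ℚ := indFun (T.S.image (· * x)) with hv
  set w : G → ℚ := v - φ v with hw
  have hvV : v ∈ T.V := T.indFun_image_mem_V x
  have hwV : w ∈ T.V := T.V.sub_mem hvV (T.rt_mem_V g hvV)
  have hw0 : w ≠ 0 := by
    intro h0
    rw [hw, sub_eq_zero, hv, hφ, T.rt_indFun_image] at h0
    exact hx (indFun_injective h0.symm)
  have hNw : normOp g p w = 0 := by
    rw [hw, map_sub, hφ, ← Module.End.mul_apply (normOp g p) (rt g), normOp_mul_rt g p hgp, sub_self]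
  have hNw' : aeval φ (cyclotomic p ℚ) w = 0 := by
    rw [hφ, ← normOp_eq_aeval_cyclotomic]; exact hNw
  -- the `(p − 1)`-dimensional piece `W`
  have hli := linearIndependent_pow_apply_of_cyclotomic φ p hw0 hNw'
  set W : Submodule ℚ (G → ℚ) := Submodule.span ℚ (Set.range fun k : Fin (p - 1) => (φ ^ (k : ℕ)) w)
    with hWdef
  have hWrank : Module.finrank ℚ W = p - 1 := by
    rw [hWdef, finrank_span_eq_card hli, Fintype.card_fin]
  have hWV : W ≤ T.V := by
    rw [hWdef, Submodule.span_le]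
    rintro _ ⟨k, rfl⟩
    show (rt g ^ (k : ℕ)) w ∈ T.V
    rw [rt_pow]
    exact T.rt_mem_V _ hwV
  have hWker : W ≤ LinearMap.ker (normOp g p) := by
    rw [hWdef, Submodule.span_le]
    rintro _ ⟨k, rfl⟩
    show normOp g p ((rt g ^ (k : ℕ)) w) = 0
    rw [rt_pow, ← Module.End.mul_apply, normOp_mul_rt_pow g p hgp, hNw]
  -- the `2`-dimensional fixed piece `V₀`
  set u₁ : G → ℚ := normOp g p (indFun T.S) with hu₁
  set u₂ : G → ℚ := fun _ => (1 : ℚ) with hu₂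
  have hli₀ := T.linearIndependent_normOp_one g p hp hp2
  set V₀ : Submodule ℚ (G → ℚ) := Submodule.span ℚ (Set.range ![u₁, u₂]) with hV₀def
  have hV₀rank : Module.finrank ℚ V₀ = 2 := by
    rw [hV₀def, finrank_span_eq_card hli₀, Fintype.card_fin]
  have hV₀V : V₀ ≤ T.V := by
    rw [hV₀def, Submodule.span_le]
    rintro _ ⟨k, rfl⟩
    fin_cases k
    · exact T.normOp_mem_V g p T.indFun_S_mem_V
    · exact T.one_mem_V
  have hV₀fix : V₀ ≤ LinearMap.ker (rt g - 1) := by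
    rw [hV₀def, Submodule.span_le]
    rintro _ ⟨k, rfl⟩
    fin_cases k
    · show rt g u₁ - u₁ = 0
      rw [hu₁, ← Module.End.mul_apply, rt_mul_normOp g p hgp, sub_self]
    · show rt g u₂ - u₂ = 0
      rw [hu₂, rt_const, sub_self]
  -- `V₀ ⊓ W = ⊥`
  have hinf : V₀ ⊓ W = ⊥ := by
    rw [eq_bot_iff]
    intro u hu
    rw [Submodule.mem_inf] at hu
    have hfix : rt g u = u := by
      have := hV₀fix hu.1
      rw [LinearMap.mem_ker, LinearMap.sub_apply, Module.End.one_apply, sub_eq_zero] at this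
      exact this
    have hker : normOp g p u = 0 := by
      have := hWker hu.2
      rwa [LinearMap.mem_ker] at this
    rw [normOp_apply_of_fixed g p hfix, smul_eq_zero] at hker
    rw [Submodule.mem_bot]
    exact hker.resolve_left (by exact_mod_cast hp.ne_zero)
  -- count dimensions
  have h1 := Submodule.finrank_sup_add_finrank_inf_eq V₀ W
  rw [hinf, finrank_bot, add_zero, hV₀rank, hWrank] at h1
  have h2 : Module.finrank ℚ ↥(V₀ ⊔ W) ≤ Module.finrank ℚ T.V :=
    Submodule.finrank_mono (sup_le hV₀V hWV)
  rw [T.rank_eq_finrank_V]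
  have := hp.two_le
  omega

end CMTriple

/-! ### Reduction to the faithful case and the discharge -/

/-- **Dodson 1987 Theorem 1.4 (Ribet) holds**: for every simple CM triple and every odd prime
`p ∣ d`, `rank ≥ p + 1` (Ribet's argument as printed by Dodson p.51–52, after the reduction to the
faithful quotient `G / normalCore H`, which preserves rank, dimension and simplicity). -/
theorem Dodson1987_theorem1_4_Ribet_holds : Dodson1987_theorem1_4_Ribet := by
  intro G _ _ _ T hs p hp hp2 hpd
  classical
  let N := T.H.normalCore
  letI : Fintype (G ⧸ N) := Fintype.ofFinite _
  have hN : N ≤ T.H := Subgroup.normalCore_le _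
  have h := (T.quotientTriple N hN).add_one_le_rank_of_core (T.quotientTriple_isSimple N hN hs)
    T.normalCore_map_eq_bot p hp hp2 (by rw [T.quotientTriple_dim]; exact hpd)
  rwa [T.quotientTriple_rank] at h

/-- **Yanai's theorem a second time, from Ribet's bound** (no character formula): a simple CM-type of
prime dimension is nondegenerate. -/
theorem Yanai1985_theorem_prime_nondegenerate_of_Ribet : Yanai1985_theorem_prime_nondegenerate := by
  intro G _ _ _ T hs hd
  have hub := T.rank_le_dim_add_one
  unfold CMTriple.IsNondegenerate
  rcases eq_or_ne T.dim 2 with hd2 | hd2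
  · have h3 := T.three_le_rank_of_isSimple hs hd.two_le
    omega
  · have h := Dodson1987_theorem1_4_Ribet_holds G T hs T.dim hd hd2 dvd_rfl
    omega

end HodgeRepro.Lit2
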